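import Summits.NavierStokesRegularity.NavierStokesRegularity.Theorems.FluidComputerLocal
import Literature.Analysis.FluidPDE.FluidComputer.ReachCertificate
import HarnessLib

/-!
# Fluid computer, REACH layer: what a circuit design with a certified reach–avoid tube gives for the true equations

HONEST FRAMING (verbatim, blueprint-wide): low prior, high value-of-information experiment on Tao's
machine paradigm; NOT a claim that NS blows up. No `ReachCircuit` is known to exist for the
Navier–Stokes equations; every theorem below is an implication from such a (so far uninhabited)
structure.

`FluidComputerLocal` recorded what a `LocalCircuit S O s` buys: guarded instantaneous dynamics
(`defect`, `junk_rate`) plus a Lipschitz design field with its flow, a tube radius `δsh` and the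
Grönwall budget `ε (e^{Lτc} - 1)/L ≤ δsh` give whole-tick SHADOWING, hence firing. Shadowing is more
than the cascade uses — `PumpGadget.fires` asks only that a loaded trajectory REACH the output class
within the tick — and Grönwall prices it exponentially in the rate–delay product `L τc`.
`Literature…FluidComputer.ReachCircuit` (bp3 gen 8) keeps the guarded dynamics verbatim and replaces
the flow / Lipschitz / tube-radius / Grönwall fields by a closed reach tube `Tube p σ ⊆ U` and ONE
finite-dimensional robust reach–avoid certificate `cert` about the design vector field `F` ("every
`ε`-approximate trajectory from `Ain` stays in the tube and visits `Aout` by rescaled time `τc`").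
Firing is again a theorem (`ReachCircuit.fires`, a bootstrap over the tick), so the pump cascade and
everything downstream follow; `LocalCircuit.toReachCircuit` exhibits the local layer as the special
case whose certificate is Grönwall's, and `Literature…FluidComputer.ReachCertificate` supplies the
certificate interface with a BARRIER inhabitant (`BarrierGate`: barrier function + progress
function, defect budget LINEAR in the margins) and re-certification (`ReachCircuit.withCertificate`,
which leaves the pump cascade literally unchanged).

This file records the summit-level consequences by composition, and the two things the reach layer
adds in content: along the blow-up trajectory the readout of the true solution lies in the CERTIFIED
TUBE of the design at every rescaled time of every generation's tick, with junk `≤ (jin + γ σ) √E_n`,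
and each generation FIRES (`readout_in_tube_of_reachCircuit`); and liveness of a barrier-certifiable
design needs `H¹⁰` control only on the safe slab `{read ∈ {V ≤ 0}, junk ≤ jrun √E_n}`
(`live_of_barrier_reachCircuit`).

Honest ceiling (ASSEMBLY.md §2j): the tolerance `ε` is now exactly the design's certificate margin —
no Grönwall loss — but for Tao's own five-mode gate that margin is itself exponentially small (bp1,
`Tao2016AveragedNS/GateFragility.lean`, `not_firesOnBudget_of_seed_mul_le`: any forcing budget above
the seed rate `ε² e^{-K¹⁰}` defeats firing). The exponential there is the price of ARMING an
exponential instability with a tiny seed, a property of that design; whether an energy-respecting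
one-scale quadratic circuit admits a delayed abrupt gate with polynomial margin is a
finite-dimensional design question the blueprint now poses precisely and does not answer. Nothing
here lowers the burden on the true equations: `defect` ∧ `junk_rate` near a genuinely computing
design is Tao's open programme.
-/

open Set Filter Topology
open scoped SchwartzMap ENNReal BigOperators

namespace Summit.NavierStokesRegularity.NavierStokesRegularity.Theorems.FluidComputer

open Literature.Analysis.FluidPDE Literature.Analysis.FluidPDE.Tao2016
open Literature.Analysis.FluidPDE.FluidComputer
open Literature.Analysis.FunctionSpaces (eFourierSobolevNorm)

variable {S : CascadeSpecs} {O : Type*} [NormedAddCommGroup O] [NormedSpace ℝ O] {s : ℝ}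

/-! ### Blow-up, stable blow-up -/

/-- **A circuit design with a certified reach–avoid tube for the true Navier–Stokes equations
refutes Clay (A)** (`α > 0`, `η > 1/4`) — through `R.toPumpCascade`. HONEST FRAMING: an implication
from an uninhabited-as-far-as-known structure; NOT a claim that NS blows up. -/
theorem ns_blowup_of_reachCircuit (R : ReachCircuit S O s) (hα : 0 < S.alpha)
    (hη : 1 / 4 < S.eta) : ¬ NavierStokesRegularity :=
  ns_blowup_of_pumpCascade R.toPumpCascade hα hη

/-- **Stable blow-up from a reach design** (`0 ≤ s`): every divergence-free Schwartz datum within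
`X^s_{λ₀}`-distance `ρ √E₀` of the seed, `ρ = min (δ/Λ) (jin - jcore)`, has all its `H¹⁰_df`-mild
Navier–Stokes trajectories of lifespan `≤ T_*`. -/
theorem stableBlowup_of_reachCircuit (R : ReachCircuit S O s) (hs : 0 ≤ s)
    (hα : 0 < S.alpha) (hη : 1 / 4 < S.eta)
    (w₀ : 𝓢(EuclideanSpace ℝ (Fin 3), EuclideanSpace ℝ (Fin 3)))
    (hdiv : VectorCalculus.IsDivFree ⇑w₀)
    (hnear : scaledSobolevNorm s (S.lam 0) (schwartzL2 w₀ - schwartzL2 R.u₀) <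
      ENNReal.ofReal (R.rho * Real.sqrt (S.Emin 0)))
    {S' : ℝ} {u : ℝ → L2C} (hu : IsMildSolutionFor eulerForm (schwartzL2 w₀) (Ico 0 S') u) :
    S' ≤ S.Tstar :=
  stableBlowup_of_robustPumpCascade (R.toRobustPumpCascade hs) hα hη w₀ hdiv hnear hu

/-- **Stable blow-up in the `H¹⁰` ball** (`0 ≤ s ≤ 10`, `λ₀ ≥ 1`): the same with the perturbation
measured in the unweighted `H¹⁰_df` norm. -/
theorem stableBlowup_H10ball_of_reachCircuit (R : ReachCircuit S O s) (hs0 : 0 ≤ s)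
    (hs10 : s ≤ 10) (hlam : 1 ≤ S.lam0) (hα : 0 < S.alpha) (hη : 1 / 4 < S.eta)
    (w₀ : 𝓢(EuclideanSpace ℝ (Fin 3), EuclideanSpace ℝ (Fin 3)))
    (hdiv : VectorCalculus.IsDivFree ⇑w₀)
    (hnear : eFourierSobolevNorm 10 (schwartzL2 w₀ - schwartzL2 R.u₀) <
      ENNReal.ofReal (R.rho * Real.sqrt (S.Emin 0)))
    {S' : ℝ} {u : ℝ → L2C} (hu : IsMildSolutionFor eulerForm (schwartzL2 w₀) (Ico 0 S') u) :
    S' ≤ S.Tstar :=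
  stableBlowup_H10ball (R.toRobustPumpCascade hs0) hs0 hs10 hlam hα hη w₀ hdiv hnear hu

/-- **No unstable blow-up profile is a reach design**: if `H¹⁰_df`-mild lifespans are not locally
bounded by `T_*` near the seed in `X^s_{λ₀}` at any positive radius, there is no reach circuit with
that seed (contrapositive of `stableBlowup_of_reachCircuit`). -/
theorem no_reachCircuit_of_unstable (R : ReachCircuit S O s) (hs : 0 ≤ s) (hα : 0 < S.alpha)
    (hη : 1 / 4 < S.eta)
    (hunst : ∀ ρ : ℝ, 0 < ρ → ∃ w₀ : 𝓢(EuclideanSpace ℝ (Fin 3), EuclideanSpace ℝ (Fin 3)),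
      VectorCalculus.IsDivFree ⇑w₀ ∧
      scaledSobolevNorm s (S.lam 0) (schwartzL2 w₀ - schwartzL2 R.u₀) <
        ENNReal.ofReal (ρ * Real.sqrt (S.Emin 0)) ∧
      ∃ S' : ℝ, ∃ u : ℝ → L2C, IsMildSolutionFor eulerForm (schwartzL2 w₀) (Ico 0 S') u ∧
        S.Tstar < S') : False := by
  obtain ⟨w₀, hdiv, hnear, S', u, hu, hlt⟩ := hunst R.rho R.rho_pos
  exact (not_le.mpr hlt) (stableBlowup_of_reachCircuit R hs hα hη w₀ hdiv hnear hu)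

/-! ### Liveness and the cascade theorem, unconditionally in the mild theory -/

/-- **A reach design with tube-level `H¹⁰` control is live**: `H10MildTheory` is a theorem for the
true equations (`h10MildTheory_holds`), so only the design-level hypothesis `R.H10Control`
(`H¹⁰`-boundedness on `{read ∈ Tube, junk ≤ jrun √E_n}`) remains. -/
theorem live_of_reachCircuit (R : ReachCircuit S O s) (hctrl : R.H10Control) :
    R.toPumpCascade.Live :=
  R.live h10MildTheory_holds hctrl

/-- **A BARRIER-certifiable reach design is live under `H¹⁰` control on the safe slab only**: if the
design's own `(F, U, ε, τc, Ain, Aout)` carry a barrier gate `G` (barrier function `V` + progress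
function), `H¹⁰`-boundedness on `{v : read_n v ∈ {V ≤ 0}, junk_n v ≤ jrun √E_n}` suffices — no
tube, no flow (`ReachCircuit.live_of_barrier`, re-certification). -/
theorem live_of_barrier_reachCircuit (R : ReachCircuit S O s)
    (G : BarrierGate R.F R.U R.ε R.τc R.Ain R.Aout)
    (hctrl : ∀ n : ℕ, ∃ M : ℝ, ∀ v : L2C, MemH10df v → R.read n v ∈ G.Safe →
      R.junk n v ≤ ENNReal.ofReal (R.jrun * Real.sqrt (S.Emin n)) →
        eFourierSobolevNorm 10 v ≤ ENNReal.ofReal M) :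
    R.toPumpCascade.Live :=
  R.live_of_barrier G h10MildTheory_holds hctrl

/-- **Every generation is loaded along the maximal trajectory** of a controlled reach design: the
seed's maximal `H¹⁰_df`-mild solution `U` on `[0, S_m)`, `S_m ≤ T_*`, with unbounded `H¹⁰` norm, is
in the generation-`n` input class at clocked instants `0 = t₀ ≤ t₁ ≤ …`, `t_{n+1} - t_n ≤ unit_n τc`. -/
theorem allGenerationsFire_of_reachCircuit (R : ReachCircuit S O s) (hα : 0 < S.alpha)
    (hη : 1 / 4 < S.eta) (hctrl : R.H10Control) :
    ∃ Sm : ℝ, 0 < Sm ∧ Sm ≤ S.Tstar ∧ ∃ U : ℝ → L2C,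
      IsMildSolutionFor eulerForm (schwartzL2 R.u₀) (Ico 0 Sm) U ∧
      (¬ ∃ S' : ℝ, Sm < S' ∧ ∃ v : ℝ → L2C,
        IsMildSolutionFor eulerForm (schwartzL2 R.u₀) (Ico 0 S') v ∧ ∀ s ∈ Ico 0 Sm, v s = U s) ∧
      (∀ C : ℝ, ∃ s ∈ Ico 0 Sm, ENNReal.ofReal C < eFourierSobolevNorm 10 (U s)) ∧
      ∃ t : ℕ → ℝ, t 0 = 0 ∧ Monotone t ∧ (∀ n, t n < Sm) ∧
        (∀ n, t (n + 1) - t n ≤ R.unit n * R.τc) ∧ ∀ n, U (t n) ∈ R.In n :=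
  allGenerationsFire R.toPumpCascade hα hη (live_of_reachCircuit R hctrl)

/-- **THE CASCADE THEOREM for a controlled reach design** (`α > 0`, `η > 1/4`): along the seed's
maximal `H¹⁰_df`-mild Navier–Stokes trajectory, for EVERY generation `n` the spec's energy `E_n` is
present at frequency `≥ λ_n` at a clocked instant `t_n ≤ ∑_{k<n} Tmax k`, `t_n < S_m ≤ T_*`, and the
`H¹⁰` norm is unbounded on `[0, S_m)` — an implication from a finite-dimensional reach certificate,
static certificates, and two instantaneous guarded inequalities. -/
theorem energy_reaches_all_scales_of_reachCircuit (R : ReachCircuit S O s)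
    (hα : 0 < S.alpha) (hη : 1 / 4 < S.eta) (hctrl : R.H10Control) :
    ∃ Sm : ℝ, 0 < Sm ∧ Sm ≤ S.Tstar ∧ ∃ U : ℝ → L2C,
      IsMildSolutionFor eulerForm (schwartzL2 R.u₀) (Ico 0 Sm) U ∧
      (∀ C : ℝ, ∃ s ∈ Ico 0 Sm, ENNReal.ofReal C < eFourierSobolevNorm 10 (U s)) ∧
      ∃ t : ℕ → ℝ, t 0 = 0 ∧ Monotone t ∧
        ∀ n, t n < Sm ∧ t n ≤ ∑ k ∈ Finset.range n, S.Tmax k ∧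
          ENNReal.ofReal (S.Emin n) ≤ highFreqEnergy (S.lam n) (U (t n)) :=
  energy_reaches_all_scales R.toPumpCascade hα hη (live_of_reachCircuit R hctrl)

/-- **The computation is visible along the blow-up trajectory, as a certified tube**: the seed's
maximal `H¹⁰_df`-mild trajectory `U` on `[0, S_m)`, `S_m ≤ T_*`, is LOADED at generation `n` at
clocked instants `0 = t₀ ≤ t₁ ≤ …`; during generation `n`'s tick the readout of the TRUE solution
lies in the design's certified reach tube `Tube (read_n U(t_n)) σ` after rescaled time `σ` while the
junk is `≤ (jin + γ σ) √E_n` — for as long as the trajectory lives (`ReachCircuit.reach_sharp`) —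
and if the whole tick fits in the lifespan the generation FIRES: the trajectory visits the output
class `Out n` within the tick (`ReachCircuit.fires`). -/
theorem readout_in_tube_of_reachCircuit (R : ReachCircuit S O s) (hα : 0 < S.alpha)
    (hη : 1 / 4 < S.eta) (hctrl : R.H10Control) :
    ∃ Sm : ℝ, 0 < Sm ∧ Sm ≤ S.Tstar ∧ ∃ U : ℝ → L2C,
      IsMildSolutionFor eulerForm (schwartzL2 R.u₀) (Ico 0 Sm) U ∧
      ∃ t : ℕ → ℝ, t 0 = 0 ∧ Monotone t ∧ (∀ n, t n < Sm) ∧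
        (∀ n, R.read n (U (t n)) ∈ R.Ain ∧
          R.junk n (U (t n)) ≤ ENNReal.ofReal (R.jin * Real.sqrt (S.Emin n))) ∧
        (∀ n σ, 0 ≤ σ → σ ≤ R.τc → t n + R.unit n * σ < Sm →
          R.read n (U (t n + R.unit n * σ)) ∈ R.Tube (R.read n (U (t n))) σ ∧
            R.junk n (U (t n + R.unit n * σ)) ≤
              ENNReal.ofReal ((R.jin + R.γ * σ) * Real.sqrt (S.Emin n))) ∧
        ∀ n, t n + R.unit n * R.τc < Sm →
          ∃ r : ℝ, t n ≤ r ∧ r ≤ t n + R.unit n * R.τc ∧ U r ∈ R.Out n := by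
  obtain ⟨Sm, hSm, hle, U, hU, -, -, t, ht0, htmono, htlt, -, hmem⟩ :=
    allGenerationsFire_of_reachCircuit R hα hη hctrl
  have ht_nonneg : ∀ n, 0 ≤ t n := fun n => ht0 ▸ htmono (Nat.zero_le n)
  refine ⟨Sm, hSm, hle, U, hU, t, ht0, htmono, htlt, fun n => hmem n,
    fun n σ hσ0 hστ hlt => ?_, fun n hT => ?_⟩
  · exact R.reach_sharp n _ Sm U hU (t n) (ht_nonneg n) (hmem n).1 (hmem n).2 σ hσ0 hστ hlt
  · exact R.fires n _ Sm U hU (t n) (ht_nonneg n) (hmem n) hT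

/-! ### The local layer is the reach layer with Grönwall's certificate -/

/-- **The local layer's pump cascade IS the reach layer's**, for the Grönwall certificate
(`LocalCircuit.toReachCircuit`): the two routes from a `LocalCircuit` to the blow-up conclusions —
via shadowing (`toShadowedCircuit`) and via reach (`toReachCircuit`) — produce literally the same
pump cascade. -/
theorem toReachCircuit_toPumpCascade (A : LocalCircuit S O s) :
    A.toReachCircuit.toPumpCascade = A.toShadowedCircuit.toPumpCascade := rfl

/-- **Re-certification is invisible downstream** at summit level: replacing the CIRCUIT group of a
reach design by any other reach certificate for the same `(F, U, ε, τc, Ain, Aout)` — e.g. a barrier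
gate's — leaves the pump cascade, hence every blow-up conclusion above, unchanged. -/
theorem withCertificate_toPumpCascade' (R : ReachCircuit S O s)
    (C : ReachCertificate R.F R.U R.ε R.τc R.Ain R.Aout) :
    (R.withCertificate C).toPumpCascade = R.toPumpCascade :=
  R.withCertificate_toPumpCascade C

end Summit.NavierStokesRegularity.NavierStokesRegularity.Theorems.FluidComputer
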